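import Summits.QuantumFields.YangMills.Theorems.BalabanUVNodesN15KingModelPotentialComplexCauchyDecay
import Summits.QuantumFields.YangMills.Theorems.BalabanUVNodesN15KingModelPotentialComplexFirstOrder

/-!
# N15 (NE2) King-model rung, PART 41 — THE LOG-DETERMINANT DENSITY OF THE DRESSED BLOCK-SPIN COVARIANCES (the Gaussian free energy per site)
# is differentiable in the coupling; its response `|Λ|⁻¹·tr(C^{(k)}_z ∂_zΔ^{(k)}_{z·v})` extends HOLOMORPHICALLY to the coupling disc and is bounded
# UNIFORMLY IN THE CUTOFF `k` AND IN THE VOLUME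

Eleventh generation (g11) of the seat `pub-ymgap-dag-n15-d`, part 41 (on 35 `…PotentialComplexCauchyDecay`, 32, 28b ∕ 28f and 9e ∕ 9f; the Literature module
`Literature.Analysis.Matrix.LogDetDerivative` — Jacobi's formula — BY NAME through 9f's import).  An INTENSIVE quantity of King's A = 0 model: the Gaussian
block-spin measure with covariance `C^{(k)}_{t·v} = (Δ^{(k)}_{t·v} + aL⁻²Q*Q)⁻¹` has free energy per unit-lattice site `½·f_k(t) + const`,
`f_k(t) := |Λ|⁻¹·log det(Δ^{(k)}_{t·v} + aL⁻²Q*Q)` (`|Λ|` = the number of unit sites).  By Jacobi's formula its coupling-derivative is the RESPONSE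
`e_k(t) = |Λ|⁻¹·tr(C^{(k)}_{t·v}·∂_tΔ^{(k)}_{t·v})`, and parts 28b∕32∕35 make `e_k` a holomorphic function of a COMPLEX coupling with a bound uniform in `k` and in
the volume:

* §1 defs `logDetDensity` (`f_k`), `dLevel` (9e's derivative matrix `∂_tΔ^{(k)}_{t·w} = a_k²N^{d+1}·Q G_t diag(w) G_t Qᵀ`), `logDetResponseC` (`e_k(z) :=
  |Λ|⁻¹·Σ_{x,y} C^{(k)}_z(x,y)·∂_ζΔ^{(k)}_{ζ·w}(y,x)|_{ζ=z}`); `hasDerivAt_kingLevelPot_smul` (9e `hasDerivAt_effLaplacianPot_smul` along King's run),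
  `deriv_kingLevelPotC_real` (the complex derivative at a real coupling IS 9e's matrix — 28f `hasDerivAt_complex_of_real_slice`), `logDetResponseC_ofReal`
  (`e_k(t) = |Λ|⁻¹·tr(C^{(k)}_{t·w}·∂_tΔ^{(k)}_{t·w})`, real);
* §2 ★★ `hasDerivAt_logDetDensity` — JACOBI: `f_k′(t) = e_k(t)` for `|t|·sup|w| < min(w̄, r_K)` (`LogDetDerivative.hasDerivAt_real_log_det`; `det ≠ 0` from 28b's
  Re-coercivity read at the real coupling);
* §3 ★ `differentiableOn_logDetResponseC` — `e_k` is HOLOMORPHIC on the ball `‖z‖ < min(r_K∕w₀, 1)` (28b ∕ 32 holomorphy; the derivative of a holomorphic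
  function on an open ball is holomorphic);
* §4 ★★★ `norm_logDetResponseC_le` — **UNIFORMLY IN THE CUTOFF AND IN THE VOLUME**: for every circle radius `ρ` with `‖z‖ + ρ < (r∕(1+r))·min(r_K∕w₀, 1)`,
  `‖e_k(z)‖ ≤ (2∕γ₀)·(M_Δ∕ρ)·K_{d+1}((1−λ(r))·2κ′)` (`M_Δ = max(a + a²ctCK, a + 2a²∕m²)`, `K_{d+1} = B4Sect5Proof.latticeConst (d+1)`) — 28b's `‖C^{(k)}_z(x,y)‖ ≤ 2∕γ₀`,
  Cauchy on 32's decaying level bound (35 `norm_iteratedDeriv_le_of_sphere`, order 1) and the volume-independent lattice-sum profile `King1986.Torus.tdistT_sumBound`.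

References (method): Jacobi's formula `d log det = tr(M⁻¹dM)` [folklore] (tree `LogDetDerivative`); Cauchy's estimate [folklore]; two-constants via 32 (BY NAME);
template [B9] Thm 3.4 p.400; King (2.13)–(2.14) p.653, (4.32)–(4.34) p.674 (the covariances whose Gaussian normalisation this is).

HONEST SCOPE.  King's A = 0 SCALAR model on any unit torus `Π ℤ∕(LM_μ)` (`L ≥ 2`, `a, m² > 0`, `k ≥ 1`); the GAUSSIAN log-determinant per site of the dressed
block-spin covariance at ONE level and its response to a scalar (φ²-type) insertion — NOT the interacting theory's vacuum energy, NOT Bałaban's `E` of [III] Thm 1,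
NOT King's renormalisation-step normalisations `Z_k` (ratios of fluctuation determinants); the two-spacing (η-)rate of the response and its `k → ∞` limit are NOT in
this file (sequel); NOT a node discharge; count-neutral.  No `sorry`, standard axioms.
-/

noncomputable section

open scoped BigOperators Matrix
open Filter Topology Metric Finset Complex

namespace Summit.QuantumFields.YangMills.BalabanUVNodes.N15.KingModel

open Literature.MathematicalPhysics.QuantumFieldTheory.Balaban1983to89 hiding blockOf
open Literature.MathematicalPhysics.QuantumFieldTheory.Balaban1983to89.B4Sect5Proof (latticeConst latticeConst_nonneg)
open Literature.MathematicalPhysics.QuantumFieldTheory.Balaban1983to89.B5Prop11Plancherel (Tor fine)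
open Literature.MathematicalPhysics.QuantumFieldTheory.Balaban1983to89.B13RealSliceEntryLetters (lam lam_nonneg lam_lt_one)
open Literature.MathematicalPhysics.QuantumFieldTheory.King1986 (aK aK_pos aK_le)
open Literature.MathematicalPhysics.QuantumFieldTheory.King1986.Torus (Qmat gam0L gam0L_pos tdistT tdistT_isPseudoDist tdistT_sumBound kapCT kapCT_pos_le
  gamA gamA_pos gamA_mono aminL aminL_pos aminL_le_aK)
open Literature.Analysis.Matrix.LogDetDerivative (hasDerivAt_real_log_det)

variable {d : ℕ}

section AnyTorus

variable (a m2 : ℝ) (L : ℕ) [NeZero L] (M : Fin (d + 1) → ℕ) [∀ μ, NeZero (M μ)]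

/-! ## §1 The objects -/

/-- **THE LOG-DETERMINANT DENSITY** `f_k(t) = |Λ|⁻¹·log det(Δ^{(k)}_{t·w} + aL⁻²Q*Q)` of the dressed block-spin covariance at level `k` (the Gaussian free
energy per unit site is `½ f_k + const`). [cite: King1986, (4.32) p.674 (A = 0; the covariance), (2.13)–(2.14) p.653] -/
def logDetDensity (k : ℕ) (w : Tor (fine (L ^ k) (fine L M)) → ℝ) (t : ℝ) : ℝ :=
  ((Fintype.card (Tor (fine L M)) : ℝ))⁻¹ * Real.log (kingLevelPot a m2 L M k (t • w) + kingBlock a L M).det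

/-- **THE COUPLING-DERIVATIVE OF THE DRESSED LEVEL** (9e's Hellmann–Feynman matrix along King's run):
`∂_tΔ^{(k)}_{t·w} = a_k²N^{d+1}·Q (A₀ + t·w)⁻¹ diag(w) (A₀ + t·w)⁻¹ Qᵀ`, `N = L^k`. [cite: King1986, (2.13)–(2.14) p.653 (A = 0)] -/
def dLevel (k : ℕ) (w : Tor (fine (L ^ k) (fine L M)) → ℝ) (t : ℝ) : Matrix (Tor (fine L M)) (Tor (fine L M)) ℝ :=
  (aK a L k ^ 2 * (((L ^ k : ℕ) : ℝ)) ^ (d + 1)) •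
    (Qmat (L ^ k) (fine L M) * ((fineOpPot (L ^ k) (fine L M) (aK a L k) (((L ^ k : ℕ) : ℝ) ^ 2) m2 (t • w))⁻¹ * Matrix.diagonal w
      * (fineOpPot (L ^ k) (fine L M) (aK a L k) (((L ^ k : ℕ) : ℝ) ^ 2) m2 (t • w))⁻¹) * (Qmat (L ^ k) (fine L M))ᵀ)

variable (d) in
/-- **THE RESPONSE AT COMPLEX COUPLING** `e_k(z) = |Λ|⁻¹·Σ_{x,y} C^{(k)}_z(x,y)·∂_ζ Δ^{(k)}_{ζ·w}(y,x)|_{ζ=z}` (`= |Λ|⁻¹·tr(C^{(k)}_z·∂_zΔ^{(k)}_{z·w})`; at a real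
coupling it is the derivative of `logDetDensity`, §2). [cite: King1986, (4.32) p.674 (A = 0 template); Balaban1985BackgroundPropagators, Thm 3.4 p.400] -/
def logDetResponseC (k : ℕ) (w : Tor (fine (L ^ k) (fine L M)) → ℝ) (z : ℂ) : ℂ :=
  ((Fintype.card (Tor (fine L M)) : ℂ))⁻¹ *
    ∑ x, ∑ y, kingCovPotC d a m2 L M k z w x y * deriv (fun ζ : ℂ => kingLevelPotC d a m2 L M k ζ w y x) z

variable {a m2 L M}

/-- **The real derivative of the dressed level at every coupling of the window** (9e `hasDerivAt_effLaplacianPot_smul` along King's run: `a_k ≥ a_min`,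
`w̄ = γ_A(a_min)∕4 < γ_A(a_k)`): for `L ≥ 2`, `a > 0`, `m² ≥ 0`, `k ≥ 1`, `|w| ≤ w₁` and `|t|·w₁ < w̄`,
`HasDerivAt (u ↦ Δ^{(k)}_{u·w}(b,b′)) (dLevel k w t (b,b′)) t`. [cite: King1986, (2.13)–(2.14) p.653 (A = 0)] -/
theorem hasDerivAt_kingLevelPot_smul (hL : 2 ≤ L) (ha : 0 < a) (hm : 0 ≤ m2) {k : ℕ} (hk : 1 ≤ k)
    {w : Tor (fine (L ^ k) (fine L M)) → ℝ} {w₁ t : ℝ} (hw : ∀ x, |w x| ≤ w₁) (ht : |t| * w₁ < wbarK (d + 1) a L) (b b' : Tor (fine L M)) :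
    HasDerivAt (fun u : ℝ => kingLevelPot a m2 L M k (u • w) b b') (dLevel a m2 L M k w t b b') t := by
  have hamin := aminL_pos ha hL
  obtain ⟨hk1, -⟩ := aminL_le_aK ha hL hk
  have hLr : (1 : ℝ) < L := by exact_mod_cast (by omega : 1 < L)
  have haK := aK_pos ha hLr hk
  have hγ := gamA_pos hamin (d + 1)
  have hmono : gamA (aminL a L) (d + 1) ≤ gamA (aK a L k) (d + 1) := gamA_mono hk1 (d + 1)
  have hw₀ : wbarK (d + 1) a L < gamA (aK a L k) (d + 1) := by
    show gamA (aminL a L) (d + 1) / 4 < gamA (aK a L k) (d + 1)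
    linarith
  have h := hasDerivAt_effLaplacianPot_smul (N := L ^ k) (U := fine L M) (a := aK a L k) (m2 := m2) haK.le hm hw ht hw₀ b b'
  simpa only [dLevel, kingLevelPot, Matrix.smul_apply, smul_eq_mul] using h

/-- **THE COMPLEX DERIVATIVE OF THE LEVEL AT A REAL COUPLING IS 9e's MATRIX**: for `L ≥ 2`, `a, m² > 0`, `k ≥ 1`, `|w| ≤ w₁`, `w₁ ≥ 0`, `|t|·w₁ < w̄` and
`|t|·w₁ < m²`: `deriv (ζ ↦ Δ^{(k)}_{ζ·w}(b,b′)) t = dLevel k w t (b,b′)` (28f's `hasDerivAt_complex_of_real_slice` on 28b's holomorphy and §1's real derivative).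
[cite: Balaban1985BackgroundPropagators, Thm 3.4 p.400 (template); King1986, (2.14) p.653] -/
theorem deriv_kingLevelPotC_real (hL : 2 ≤ L) (ha : 0 < a) (hm : 0 < m2) {k : ℕ} (hk : 1 ≤ k)
    {w : Tor (fine (L ^ k) (fine L M)) → ℝ} {w₁ t : ℝ} (hw : ∀ x, |w x| ≤ w₁) (ht : |t| * w₁ < wbarK (d + 1) a L) (htm : |t| * w₁ < m2)
    (b b' : Tor (fine L M)) :
    HasDerivAt (fun ζ : ℂ => kingLevelPotC d a m2 L M k ζ w b b') ((dLevel a m2 L M k w t b b' : ℝ) : ℂ) (t : ℂ) ∧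
      deriv (fun ζ : ℂ => kingLevelPotC d a m2 L M k ζ w b b') (t : ℂ) = ((dLevel a m2 L M k w t b b' : ℝ) : ℂ) := by
  have hLr : (1 : ℝ) < L := by exact_mod_cast (by omega : 1 < L)
  have haK := aK_pos ha hLr hk
  have hzm : ‖(t : ℂ)‖ * w₁ < m2 := by rwa [Complex.norm_real, Real.norm_eq_abs]
  have hdiff : DifferentiableAt ℂ (fun ζ : ℂ => kingLevelPotC d a m2 L M k ζ w b b') (t : ℂ) :=
    differentiableAt_effLaplacianPotC_apply (N := L ^ k) (U := fine L M) (a := aK a L k) (c := ((L ^ k : ℕ) : ℝ) ^ 2) (m2 := m2)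
      haK.le (by positivity) hw hzm b b'
  have hslice : ∀ s : ℝ, kingLevelPotC d a m2 L M k (s : ℂ) w b b' = ((kingLevelPot a m2 L M k (s • w) b b' : ℝ) : ℂ) := fun s => by
    rw [kingLevelPotC_ofReal, Matrix.map_apply]
  have h := hasDerivAt_complex_of_real_slice hdiff hslice (hasDerivAt_kingLevelPot_smul hL ha hm.le hk hw ht b b')
  exact ⟨h, h.deriv⟩

/-- **AT A REAL COUPLING THE RESPONSE IS JACOBI's TRACE**: `e_k(t) = |Λ|⁻¹·tr(C^{(k)}_{t·w}·∂_tΔ^{(k)}_{t·w})`, read over ℂ. [folklore] -/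
theorem logDetResponseC_ofReal (hL : 2 ≤ L) (ha : 0 < a) (hm : 0 < m2) {k : ℕ} (hk : 1 ≤ k)
    {w : Tor (fine (L ^ k) (fine L M)) → ℝ} {w₁ t : ℝ} (hw : ∀ x, |w x| ≤ w₁) (ht : |t| * w₁ < wbarK (d + 1) a L) (htm : |t| * w₁ < m2) :
    logDetResponseC d a m2 L M k w (t : ℂ)
      = ((((Fintype.card (Tor (fine L M)) : ℝ))⁻¹ *
          ((kingLevelPot a m2 L M k (t • w) + kingBlock a L M)⁻¹ * dLevel a m2 L M k w t).trace : ℝ) : ℂ) := by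
  unfold logDetResponseC
  rw [Matrix.trace]
  simp only [Matrix.diag_apply, Matrix.mul_apply]
  push_cast
  congr 1
  refine sum_congr rfl fun x _ => sum_congr rfl fun y _ => ?_
  rw [(deriv_kingLevelPotC_real hL ha hm hk hw ht htm y x).2, kingCovPotC_ofReal, Matrix.map_apply]

/-! ## §2 Jacobi: the log-determinant density is differentiable with derivative the response -/

/-- The matrix `Δ^{(k)}_{t·w} + aL⁻²Q*Q` is invertible at every real coupling of the window `|t|·w₁ ≤ r_K` (28b's Re-coercivity read at a real `z`). [folklore] -/
theorem det_kingLevelPot_add_block_ne_zero (ha : 0 < a) (hm : 0 < m2) (hL : 2 ≤ L) {k : ℕ} (hk : 1 ≤ k)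
    {w : Tor (fine (L ^ k) (fine L M)) → ℝ} {w₁ t : ℝ} (hw₁ : 0 ≤ w₁) (hw : ∀ x, |w x| ≤ w₁) (htc : |t| * w₁ ≤ cplxWindow d a m2 L) :
    (kingLevelPot a m2 L M k (t • w) + kingBlock a L M).det ≠ 0 := by
  have hz : ‖(t : ℂ)‖ * w₁ ≤ cplxWindow d a m2 L := by rwa [Complex.norm_real, Real.norm_eq_abs]
  have hu := isUnit_det_kingLevelPotC_add_block (M := M) ha hm hL hk hw₁ hw hz
  rw [kingLevelPotC_ofReal, ← map_ofReal_add] at hu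
  intro h0
  have hdet : ((kingLevelPot a m2 L M k (t • w) + kingBlock a L M).map Complex.ofReal).det
      = (((kingLevelPot a m2 L M k (t • w) + kingBlock a L M).det : ℝ) : ℂ) := by
    have h := RingHom.map_det Complex.ofRealHom (kingLevelPot a m2 L M k (t • w) + kingBlock a L M)
    rw [RingHom.mapMatrix_apply] at h
    exact h.symm
  rw [hdet, h0, Complex.ofReal_zero] at hu
  exact not_isUnit_zero hu

/-- ★★ **JACOBI's FORMULA FOR THE LOG-DETERMINANT DENSITY** — the Gaussian free energy per site is differentiable in the coupling with derivative the
response: for `L ≥ 2`, `a, m² > 0`, `k ≥ 1`, `|w| ≤ w₁` (`w₁ ≥ 0`) and every real `t` with `|t|·w₁ < w̄` and `|t|·w₁ ≤ r_K`: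
`HasDerivAt f_k (|Λ|⁻¹·tr(C^{(k)}_{t·w}·∂_tΔ^{(k)}_{t·w})) t`, and this derivative is `Re e_k(t)` (`Im e_k(t) = 0`).
(`Literature.Analysis.Matrix.LogDetDerivative.hasDerivAt_real_log_det` BY NAME; the block term is constant in `t`.)
[cite: King1986, (4.32) p.674 (A = 0; the covariance); AlbergoEtAl2021Fermions, App. C (Jacobi's formula, the tree's port)] -/
theorem hasDerivAt_logDetDensity (ha : 0 < a) (hm : 0 < m2) (hL : 2 ≤ L) {k : ℕ} (hk : 1 ≤ k)
    {w : Tor (fine (L ^ k) (fine L M)) → ℝ} {w₁ t : ℝ} (hw₁ : 0 ≤ w₁) (hw : ∀ x, |w x| ≤ w₁) (ht : |t| * w₁ < wbarK (d + 1) a L)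
    (htc : |t| * w₁ ≤ cplxWindow d a m2 L) :
    HasDerivAt (logDetDensity a m2 L M k w)
        (((Fintype.card (Tor (fine L M)) : ℝ))⁻¹ * ((kingLevelPot a m2 L M k (t • w) + kingBlock a L M)⁻¹ * dLevel a m2 L M k w t).trace) t ∧
      logDetResponseC d a m2 L M k w (t : ℂ)
        = ((((Fintype.card (Tor (fine L M)) : ℝ))⁻¹ * ((kingLevelPot a m2 L M k (t • w) + kingBlock a L M)⁻¹ * dLevel a m2 L M k w t).trace : ℝ) : ℂ) := by
  have htm : |t| * w₁ < m2 := lt_of_le_of_lt (htc.trans (min_le_left _ _)) (by linarith)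
  refine ⟨?_, logDetResponseC_ofReal hL ha hm hk hw ht htm⟩
  have hM : ∀ i j, HasDerivAt (fun s : ℝ => (kingLevelPot a m2 L M k (s • w) + kingBlock a L M) i j) (dLevel a m2 L M k w t i j) t := by
    intro i j
    simp only [Matrix.add_apply]
    simpa using (hasDerivAt_kingLevelPot_smul hL ha hm.le hk hw ht i j).add_const (kingBlock a L M i j)
  have h := hasDerivAt_real_log_det (M := fun s : ℝ => kingLevelPot a m2 L M k (s • w) + kingBlock a L M) hM
    (det_kingLevelPot_add_block_ne_zero ha hm hL hk hw₁ hw htc)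
  unfold logDetDensity
  exact h.const_mul _

/-! ## §3 The response is holomorphic on the coupling ball -/

/-- ★ **THE RESPONSE IS HOLOMORPHIC** on the ball `‖z‖ < min(r_K∕w₀, 1)` (`k ≥ 1`, `sup|w| ≤ w₀`, `w₀ > 0`): finite sums of products of the holomorphic covariance
entries (32) and of the derivatives of the holomorphic level entries (holomorphic on the open ball). [cite: Balaban1985BackgroundPropagators, Thm 3.4 p.400 (template)] -/
theorem differentiableOn_logDetResponseC (ha : 0 < a) (hm : 0 < m2) (hL : 2 ≤ L) {k : ℕ} (hk : 1 ≤ k)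
    {w : Tor (fine (L ^ k) (fine L M)) → ℝ} {w₀ : ℝ} (hw₀ : 0 < w₀) (hw : ∀ x, |w x| ≤ w₀) :
    DifferentiableOn ℂ (logDetResponseC d a m2 L M k w) (ball 0 (min (cplxWindow d a m2 L / w₀) 1)) := by
  have hC := fun x y => differentiableOn_kingCovPotC_ball (d := d) (a := a) (m2 := m2) (M := M) ha hm hL hk hw₀ hw x y
  have hD : ∀ y x, DifferentiableOn ℂ (deriv fun ζ : ℂ => kingLevelPotC d a m2 L M k ζ w y x) (ball 0 (min (cplxWindow d a m2 L / w₀) 1)) :=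
    fun y x => ((differentiableOn_kingLevelPotC_ball (d := d) ha hm hL hk hw₀ hw y x).analyticOnNhd isOpen_ball).deriv.differentiableOn
  unfold logDetResponseC
  refine DifferentiableOn.const_mul ?_ _
  refine DifferentiableOn.fun_sum fun x _ => DifferentiableOn.fun_sum fun y _ => ?_
  exact (hC x y).mul (hD y x)

/-! ## §4 The response is bounded uniformly in the cutoff and in the volume -/

/-- The lattice-sum profile turns the Cauchy-with-decay bound of the level derivatives into a volume-independent ROW-SUM bound:
`Σ_x ‖∂_z Δ^{(k)}_{z·w}(y,x)‖ ≤ (M_Δ∕ρ)·K_{d+1}((1−λ)·2κ′)`. [folklore] -/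
theorem rowSum_deriv_kingLevelPotC_le (ha : 0 < a) (hm : 0 < m2) (hL : 2 ≤ L) {k : ℕ} (hk : 1 ≤ k)
    {v : ∀ N : ℕ, Tor (fine N (fine L M)) → ℝ} {w₀ : ℝ} (hw₀ : 0 < w₀) (hwb : w₀ ≤ wbarK (d + 1) a L) (hv : ∀ N x, |v N x| ≤ w₀)
    {r : ℝ} (hr0 : 0 < r) (hr1 : r < 1) {z : ℂ} {ρ : ℝ} (hρ : 0 < ρ) (hzρ : ‖z‖ + ρ < r / (1 + r) * min (cplxWindow d a m2 L / w₀) 1)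
    (y : Tor (fine L M)) :
    ∑ x, ‖deriv (fun ζ : ℂ => kingLevelPotC d a m2 L M k ζ (v (L ^ k)) y x) z‖
      ≤ max (a + a ^ 2 * ctCK (d + 1) a L) (a + 2 * a ^ 2 / m2) / ρ * latticeConst (d + 1) ((1 - lam r) * (2 * kapCT (d + 1) a L)) := by
  have hwin := cplxWindow_pos (d := d) (a := a) (m2 := m2) (L := L) ha hm hL
  have hκ := (kapCT_pos_le (d := d + 1) ha hL).1
  have hlam1 := lam_lt_one r
  have hc : 0 < (1 - lam r) * (2 * kapCT (d + 1) a L) := by nlinarith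
  set MΔ : ℝ := max (a + a ^ 2 * ctCK (d + 1) a L) (a + 2 * a ^ 2 / m2) with hMΔ
  have hMΔ0 : 0 ≤ MΔ := le_trans (by have := (dressedConsts_nonneg (d := d) (a := a) (L := L) ha hL).1; positivity) (le_max_left _ _)
  have hrad : r / (1 + r) * min (cplxWindow d a m2 L / w₀) 1 ≤ min (cplxWindow d a m2 L / w₀) 1 := by
    have h1 : r / (1 + r) ≤ 1 := (div_le_one (by linarith)).2 (by linarith)
    have h2 : 0 ≤ min (cplxWindow d a m2 L / w₀) 1 := le_min (div_pos hwin hw₀).le zero_le_one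
    calc r / (1 + r) * min (cplxWindow d a m2 L / w₀) 1 ≤ 1 * min (cplxWindow d a m2 L / w₀) 1 := mul_le_mul_of_nonneg_right h1 h2
      _ = _ := one_mul _
  -- Cauchy (order 1) with 32's decaying level bound on the circle
  have hentry : ∀ x, ‖deriv (fun ζ : ℂ => kingLevelPotC d a m2 L M k ζ (v (L ^ k)) y x) z‖
      ≤ MΔ / ρ * Real.exp (-(((1 - lam r) * (2 * kapCT (d + 1) a L)) * tdistT (fine L M) y x)) := by
    intro x
    have h := norm_iteratedDeriv_le_of_sphere (f := fun ζ : ℂ => kingLevelPotC d a m2 L M k ζ (v (L ^ k)) y x) hρ hzρ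
      ((differentiableOn_kingLevelPotC_ball (d := d) ha hm hL hk hw₀ (hv _) y x).mono (ball_subset_ball hrad))
      (fun ζ hζ => kingLevelPotC_apply_decay (M := M) (m2 := m2) ha hm hL hk hw₀ hwb hv hr0 hr1
        (mem_ball_zero_iff.1 (closedBall_subset_ball_of_norm_add_lt hzρ (sphere_subset_closedBall hζ))) y x) 1
    rw [iteratedDeriv_one, Nat.factorial_one, Nat.cast_one, one_mul, pow_one] at h
    calc _ ≤ MΔ * Real.exp (-((1 - lam r) * (2 * kapCT (d + 1) a L) * tdistT (fine L M) y x)) / ρ := h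
      _ = MΔ / ρ * Real.exp (-(((1 - lam r) * (2 * kapCT (d + 1) a L)) * tdistT (fine L M) y x)) := by ring
  calc ∑ x, ‖deriv (fun ζ : ℂ => kingLevelPotC d a m2 L M k ζ (v (L ^ k)) y x) z‖
      ≤ ∑ x, MΔ / ρ * Real.exp (-(((1 - lam r) * (2 * kapCT (d + 1) a L)) * tdistT (fine L M) y x)) := sum_le_sum fun x _ => hentry x
    _ = MΔ / ρ * ∑ x, Real.exp (-(((1 - lam r) * (2 * kapCT (d + 1) a L)) * tdistT (fine L M) y x)) := by rw [mul_sum]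
    _ ≤ MΔ / ρ * latticeConst (d + 1) ((1 - lam r) * (2 * kapCT (d + 1) a L)) :=
        mul_le_mul_of_nonneg_left (tdistT_sumBound (fine L M) _ hc y) (div_nonneg hMΔ0 hρ.le)

/-- ★★★ **THE RESPONSE IS BOUNDED UNIFORMLY IN THE CUTOFF AND IN THE VOLUME.**  For `L ≥ 2`, `a, m² > 0`, `k ≥ 1`, a potential tower with `sup|v_N| ≤ w₀`,
`0 < w₀ ≤ w̄`, every `0 < r < 1` and every coupling `z` and radius `ρ > 0` with `‖z‖ + ρ < (r∕(1+r))·min(r_K∕w₀, 1)`: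
`‖e_k(z)‖ ≤ (2∕γ₀)·(M_Δ∕ρ)·K_{d+1}((1−λ(r))·2κ′)` — every constant independent of `k`, of the torus `M` (the volume) and of `v`
(`|Λ|⁻¹·Σ_x Σ_y ‖C(x,y)‖·‖∂Δ(y,x)‖ ≤ |Λ|⁻¹·Σ_y (2∕γ₀)·Σ_x ‖∂Δ(y,x)‖`, 28b's entry bound and the row-sum bound above).
[cite: King1986, (4.33)–(4.34) p.674 (A = 0 template); Balaban1985BackgroundPropagators, Thm 3.4 p.400; Ransford1995, Thm. 4.3.7] -/
theorem norm_logDetResponseC_le (ha : 0 < a) (hm : 0 < m2) (hL : 2 ≤ L) {k : ℕ} (hk : 1 ≤ k)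
    {v : ∀ N : ℕ, Tor (fine N (fine L M)) → ℝ} {w₀ : ℝ} (hw₀ : 0 < w₀) (hwb : w₀ ≤ wbarK (d + 1) a L) (hv : ∀ N x, |v N x| ≤ w₀)
    {r : ℝ} (hr0 : 0 < r) (hr1 : r < 1) {z : ℂ} {ρ : ℝ} (hρ : 0 < ρ) (hzρ : ‖z‖ + ρ < r / (1 + r) * min (cplxWindow d a m2 L / w₀) 1) :
    ‖logDetResponseC d a m2 L M k (v (L ^ k)) z‖
      ≤ 2 / gam0L (d + 1) a L * (max (a + a ^ 2 * ctCK (d + 1) a L) (a + 2 * a ^ 2 / m2) / ρ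
          * latticeConst (d + 1) ((1 - lam r) * (2 * kapCT (d + 1) a L))) := by
  have hγ := gam0L_pos (d := d + 1) ha hL
  have hwin := cplxWindow_pos (d := d) (a := a) (m2 := m2) (L := L) ha hm hL
  set B : ℝ := max (a + a ^ 2 * ctCK (d + 1) a L) (a + 2 * a ^ 2 / m2) / ρ * latticeConst (d + 1) ((1 - lam r) * (2 * kapCT (d + 1) a L)) with hB
  set n : ℕ := Fintype.card (Tor (fine L M)) with hn
  have hnpos : 0 < n := Fintype.card_pos
  have hn0 : (0 : ℝ) < n := by exact_mod_cast hnpos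
  -- ‖z‖·w₀ ≤ r_K for the entry bound 2/γ₀
  have hrad : r / (1 + r) * min (cplxWindow d a m2 L / w₀) 1 ≤ min (cplxWindow d a m2 L / w₀) 1 := by
    have h1 : r / (1 + r) ≤ 1 := (div_le_one (by linarith)).2 (by linarith)
    have h2 : 0 ≤ min (cplxWindow d a m2 L / w₀) 1 := le_min (div_pos hwin hw₀).le zero_le_one
    calc r / (1 + r) * min (cplxWindow d a m2 L / w₀) 1 ≤ 1 * min (cplxWindow d a m2 L / w₀) 1 := mul_le_mul_of_nonneg_right h1 h2
      _ = _ := one_mul _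
  have hz1 : z ∈ ball (0 : ℂ) (min (cplxWindow d a m2 L / w₀) 1) := by
    rw [mem_ball_zero_iff]; linarith [norm_nonneg z, hρ]
  have hzw := norm_mul_le_cplxWindow_of_mem_ball (d := d) (a := a) (m2 := m2) (L := L) hw₀ hz1
  have hC : ∀ x y, ‖kingCovPotC d a m2 L M k z (v (L ^ k)) x y‖ ≤ 2 / gam0L (d + 1) a L := fun x y =>
    kingCovPotC_apply_norm_le (M := M) ha hm hL hk hw₀.le (hv _) hzw x y
  have hrow := rowSum_deriv_kingLevelPotC_le (M := M) ha hm hL hk hw₀ hwb hv hr0 hr1 hρ hzρ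
  -- the double sum
  have hsum : ‖∑ x, ∑ y, kingCovPotC d a m2 L M k z (v (L ^ k)) x y * deriv (fun ζ : ℂ => kingLevelPotC d a m2 L M k ζ (v (L ^ k)) y x) z‖
      ≤ n * (2 / gam0L (d + 1) a L * B) := by
    calc _ ≤ ∑ x, ‖∑ y, kingCovPotC d a m2 L M k z (v (L ^ k)) x y * deriv (fun ζ : ℂ => kingLevelPotC d a m2 L M k ζ (v (L ^ k)) y x) z‖ :=
          norm_sum_le _ _
      _ ≤ ∑ x, ∑ y, 2 / gam0L (d + 1) a L * ‖deriv (fun ζ : ℂ => kingLevelPotC d a m2 L M k ζ (v (L ^ k)) y x) z‖ := by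
          refine sum_le_sum fun x _ => (norm_sum_le _ _).trans (sum_le_sum fun y _ => ?_)
          rw [norm_mul]
          exact mul_le_mul_of_nonneg_right (hC x y) (norm_nonneg _)
      _ = 2 / gam0L (d + 1) a L * ∑ y, ∑ x, ‖deriv (fun ζ : ℂ => kingLevelPotC d a m2 L M k ζ (v (L ^ k)) y x) z‖ := by
          rw [sum_comm, mul_sum]
          refine sum_congr rfl fun y _ => ?_
          rw [mul_sum]
      _ ≤ 2 / gam0L (d + 1) a L * ∑ _y : Tor (fine L M), B :=
          mul_le_mul_of_nonneg_left (sum_le_sum fun y _ => hrow y) (by positivity)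
      _ = n * (2 / gam0L (d + 1) a L * B) := by rw [sum_const, card_univ, nsmul_eq_mul, hn]; ring
  unfold logDetResponseC
  rw [norm_mul, norm_inv, Complex.norm_natCast]
  calc (n : ℝ)⁻¹ * ‖∑ x, ∑ y, kingCovPotC d a m2 L M k z (v (L ^ k)) x y * deriv (fun ζ : ℂ => kingLevelPotC d a m2 L M k ζ (v (L ^ k)) y x) z‖
      ≤ (n : ℝ)⁻¹ * (n * (2 / gam0L (d + 1) a L * B)) := mul_le_mul_of_nonneg_left hsum (inv_nonneg.mpr hn0.le)
    _ = 2 / gam0L (d + 1) a L * B := by rw [← mul_assoc, inv_mul_cancel₀ hn0.ne', one_mul]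

end AnyTorus

end Summit.QuantumFields.YangMills.BalabanUVNodes.N15.KingModel

end
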